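import Literature.Dynamics.Contraction.BirkhoffContractionCrossRatio
import HarnessLib

/-!
# Birkhoff's contraction theorem, III: Hopf's integral form — rows and vectors on a measure space
# (E. Hopf 1963; Eveson–Nussbaum 1995 Thm 3.5 and Thm 6.3)

Topic `Literature/Dynamics/Contraction`; companion of `BirkhoffContractionCrossRatio.lean` (the finite-index cross-ratio form,
whose algebra `four_var_le`, `tanh_quarter_nonneg`, `two_mul_log_birkhoff_le_tanh_mul` is used here BY NAME).  THEOREMS ONLY
(no definition, no named fact).

THE SETTING is E. Hopf's [Hopf1963]: a positive integral kernel acting on functions on a measure space — Eveson–Nussbaum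
[EvesonNussbaum1995] Thm 3.5 p. 39 states Birkhoff's theorem for general cones (which covers both the finite and the integral
case) and Thm 6.3 pp. 52–53 (after Hopf) computes the projective diameter of the integral operator
`(Ax)(s) = ∫ k(s,t) x(t) μ(dt)` with a positive continuous kernel as `Δ(A) = log max k(s,t)k(u,v)∕(k(s,v)k(u,t))`.  This file
is the finite theorem of `BirkhoffContractionCrossRatio.lean` with `Σ_{k ∈ s}` replaced by `∫ … dμ` over an s-finite measure
space: rows `a, b > 0` with cross-ratios `a s · b s′ ≤ e^Δ · a s′ · b s`, vectors `x, y > 0` with `y s · x s′ ≤ e^d · x s · y s′`,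
the four products integrable ⇒ `(∫ a y)(∫ b x)·(e^{d∕2} + e^{Δ∕2})² ≤ (∫ a x)(∫ b y)·(e^{(d+Δ)∕2} + 1)²`, hence
`(∫ a y)(∫ b x) ≤ e^{tanh(Δ∕4)·d}·(∫ a x)(∫ b y)`; the weak bounds `≤ e^d` (any non-negative rows) and `≤ e^Δ` (any
non-negative vectors); and the geometric contraction of two positive densities evolved by the same positive kernels of
diameter `≤ Δ`.  The proof is the finite one with the cross-ratio passage done by Fubini (`integral_prod_mul` on `μ.prod μ`)
and the dictionary read on the four real numbers `∫ a x`, `∫ a y`, `∫ b x`, `∫ b y`.  Hypotheses are stated EVERYWHERE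
rather than μ-a.e. (a SHAPE; modify on a null set to apply).

CONTENTS.  §0 `integral_pos_of_pos`, `integral_mul_sub_eq`, `integral_mul_sub_eq'` (plumbing); §1
`integral_mul_integral_le_birkhoff` (`p, q, α` form); §2 `integral_mul_integral_le_birkhoff_exp` (the sharp value) ·
`integral_mul_integral_le_exp_tanh_mul` (Birkhoff's coefficient) · `integral_mul_integral_le_exp_dist` (WEAK BOUND I) ·
`integral_mul_integral_le_exp_diam` (WEAK BOUND II); §3 `densityChain_pos` · `densityChain_dist_le_pow`.

PROVENANCE.  Typed (2026-08-28) by seat `pub-ymgap-dag-n19-w2` g6 as the count-neutral Summits helper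
`Summits/QuantumFields/YangMills/Theorems/BalabanUVNodesN19BirkhoffContractionIntegral.lean`; lifted here verbatim (statements
and proofs), namespace and provenance tags adapted, as the measure-space half of the Literature home of the Birkhoff–Hopf
theorem (the finite half being `BirkhoffContractionCrossRatio.lean`, p623027).  Loci read on the held copy
[corpus:paper:doi-10-1017-s0305004100072911 p0009 Thm 3.5, p0022–p0023 Thm 6.3 and Remark 6.4].

HONEST FRAMING.  Textbook positive-operator theory; nothing here concerns any summit.  No `def`, no `instance`, no `sorry`;
standard axioms.

## References
* [Hopf1963] E. Hopf, *An inequality for positive linear integral operators*, J. Math. Mech. 12 (1963) 683–692.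
* [EvesonNussbaum1995] S. P. Eveson, R. D. Nussbaum, Math. Proc. Camb. Phil. Soc. 117 (1995) 31–55: Thm 3.5 (p. 39), Thm 6.3
  (10)–(11) and Remark 6.4 (pp. 52–54).
* [LemmensNussbaum2014] B. Lemmens, R. D. Nussbaum, Handbook of Hilbert Geometry (EMS 2014) 275–303 = arXiv:1304.7921,
  Thm 2.9, Thm 2.11, §2.2 (Perron–Frobenius / transfer operators).
-/

noncomputable section

open MeasureTheory Real

namespace Literature.Dynamics.Contraction

namespace BirkhoffHopf

variable {X : Type*} [MeasurableSpace X] {μ : Measure X}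

/-- An everywhere-positive integrable function on a non-zero measure space has positive integral (plumbing).
[cite: EvesonNussbaum1995, Thm 6.3 (proof, p. 53: positivity of the integrals)] -/
theorem integral_pos_of_pos (hμ : μ ≠ 0) {f : X → ℝ} (hf : ∀ s, 0 < f s) (hfi : Integrable f μ) :
    0 < ∫ s, f s ∂μ := by
  rw [integral_pos_iff_support_of_nonneg_ae (Filter.Eventually.of_forall fun s => (hf s).le) hfi]
  have hs : Function.support f = Set.univ := Set.eq_univ_of_forall fun s => (hf s).ne'
  rw [hs]
  exact pos_iff_ne_zero.2 (by rwa [Ne, Measure.measure_univ_eq_zero])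

/-- Linearity dictionary: `∫ a·(y − αx) = ∫ a y − α ∫ a x` (plumbing). [cite: EvesonNussbaum1995, Thm 3.5 (proof, §5)] -/
theorem integral_mul_sub_eq {a x y : X → ℝ} {α : ℝ}
    (hax : Integrable (fun s => a s * x s) μ) (hay : Integrable (fun s => a s * y s) μ) :
    ∫ s, a s * (y s - α * x s) ∂μ = (∫ s, a s * y s ∂μ) - α * ∫ s, a s * x s ∂μ := by
  have e : (fun s => a s * (y s - α * x s)) = fun s => a s * y s - α * (a s * x s) := funext fun s => by ring
  rw [e, integral_sub hay (hax.const_mul α), integral_const_mul]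

/-- Linearity dictionary: `∫ a·(βx − y) = β ∫ a x − ∫ a y` (plumbing). [cite: EvesonNussbaum1995, Thm 3.5 (proof, §5)] -/
theorem integral_mul_sub_eq' {a x y : X → ℝ} {β : ℝ}
    (hax : Integrable (fun s => a s * x s) μ) (hay : Integrable (fun s => a s * y s) μ) :
    ∫ s, a s * (β * x s - y s) ∂μ = β * (∫ s, a s * x s ∂μ) - ∫ s, a s * y s ∂μ := by
  have e : (fun s => a s * (β * x s - y s)) = fun s => β * (a s * x s) - a s * y s := funext fun s => by ring
  rw [e, integral_sub (hax.const_mul β) hay, integral_const_mul]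

/-! ## §1 Hopf's integral form of Birkhoff's two-row inequality -/

section TwoRows

variable [SFinite μ] {a b x y : X → ℝ} {α p q d Δ : ℝ}

/-- **BIRKHOFF's TWO-ROW INEQUALITY, INTEGRAL FORM** [cite: EvesonNussbaum1995, Thm 3.5 p. 39 with Thm 6.3 (11) p. 52; Hopf1963].  On a σ-finite measure space: rows
`a, b > 0` with cross-ratios `a s·b s′ ≤ q²·a s′·b s` (`q ≥ 1`), a vector `x > 0` and `αx ≤ y ≤ p²αx` (`α > 0`, `p ≥ 1`), the four products integrable ⇒
`(∫ a y)(∫ b x)(p + q)² ≤ (∫ a x)(∫ b y)(pq + 1)²`.  Proof: `u_a = ∫ a y − α∫ a x`, `v_a = p²α∫ a x − ∫ a y` (and `u_b, v_b`) are non-negative, the rows'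
cross-ratio bound passes to `u_a v_b ≤ q² u_b v_a` by Fubini, and `four_var_le` concludes. -/
theorem integral_mul_integral_le_birkhoff (hp : 1 ≤ p) (hq : 1 ≤ q) (hα : 0 < α)
    (ha : ∀ s, 0 < a s) (hb : ∀ s, 0 < b s) (hx : ∀ s, 0 < x s)
    (hlo : ∀ s, α * x s ≤ y s) (hhi : ∀ s, y s ≤ p ^ 2 * (α * x s))
    (hcross : ∀ s s', a s * b s' ≤ q ^ 2 * (a s' * b s))
    (hax : Integrable (fun s => a s * x s) μ) (hay : Integrable (fun s => a s * y s) μ)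
    (hbx : Integrable (fun s => b s * x s) μ) (hby : Integrable (fun s => b s * y s) μ) :
    (∫ s, a s * y s ∂μ) * (∫ s, b s * x s ∂μ) * (p + q) ^ 2 ≤
      (∫ s, a s * x s ∂μ) * (∫ s, b s * y s ∂μ) * (p * q + 1) ^ 2 := by
  by_cases hμ : μ = 0
  · subst hμ; simp
  rcases eq_or_lt_of_le hp with rfl | hp1
  · -- `p = 1`: `y = αx`, both sides coincide
    have hyx : ∀ s, y s = α * x s := fun s => le_antisymm (by simpa using hhi s) (hlo s)
    have e1 : ∫ s, a s * y s ∂μ = α * ∫ s, a s * x s ∂μ := by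
      rw [← integral_const_mul]; exact integral_congr_ae (Filter.Eventually.of_forall fun s => by simp only [hyx s]; ring)
    have e2 : ∫ s, b s * y s ∂μ = α * ∫ s, b s * x s ∂μ := by
      rw [← integral_const_mul]; exact integral_congr_ae (Filter.Eventually.of_forall fun s => by simp only [hyx s]; ring)
    rw [e1, e2]
    exact le_of_eq (by ring)
  -- `p > 1`
  set Ay := ∫ s, a s * y s ∂μ with hAy
  set Ax := ∫ s, a s * x s ∂μ with hAx
  set By := ∫ s, b s * y s ∂μ with hBy
  set Bx := ∫ s, b s * x s ∂μ with hBx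
  -- the four non-negativities
  have hua : α * Ax ≤ Ay := by
    rw [hAx, hAy, ← integral_const_mul]
    exact integral_mono (hax.const_mul α) hay fun s => by
      have := mul_le_mul_of_nonneg_left (hlo s) (ha s).le
      simpa only [mul_comm, mul_left_comm, mul_assoc] using this
  have hva : Ay ≤ p ^ 2 * α * Ax := by
    rw [hAx, hAy, ← integral_const_mul]
    exact integral_mono hay (hax.const_mul (p ^ 2 * α)) fun s => by
      have := mul_le_mul_of_nonneg_left (hhi s) (ha s).le
      simp only at this ⊢; nlinarith [this]
  have hub : α * Bx ≤ By := by
    rw [hBx, hBy, ← integral_const_mul]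
    exact integral_mono (hbx.const_mul α) hby fun s => by
      have := mul_le_mul_of_nonneg_left (hlo s) (hb s).le
      simpa only [mul_comm, mul_left_comm, mul_assoc] using this
  have hvb : By ≤ p ^ 2 * α * Bx := by
    rw [hBx, hBy, ← integral_const_mul]
    exact integral_mono hby (hbx.const_mul (p ^ 2 * α)) fun s => by
      have := mul_le_mul_of_nonneg_left (hhi s) (hb s).le
      simp only at this ⊢; nlinarith [this]
  -- the cross-ratio bound passes to `(u, v)` by Fubini
  have hFa : Integrable (fun s => a s * (y s - α * x s)) μ := by
    have e : (fun s => a s * (y s - α * x s)) = fun s => a s * y s - α * (a s * x s) := funext fun s => by ring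
    rw [e]; exact hay.sub (hax.const_mul α)
  have hFb : Integrable (fun s => b s * (y s - α * x s)) μ := by
    have e : (fun s => b s * (y s - α * x s)) = fun s => b s * y s - α * (b s * x s) := funext fun s => by ring
    rw [e]; exact hby.sub (hbx.const_mul α)
  have hGa : Integrable (fun s => a s * (p ^ 2 * α * x s - y s)) μ := by
    have e : (fun s => a s * (p ^ 2 * α * x s - y s)) = fun s => p ^ 2 * α * (a s * x s) - a s * y s := funext fun s => by ring
    rw [e]; exact (hax.const_mul _).sub hay
  have hGb : Integrable (fun s => b s * (p ^ 2 * α * x s - y s)) μ := by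
    have e : (fun s => b s * (p ^ 2 * α * x s - y s)) = fun s => p ^ 2 * α * (b s * x s) - b s * y s := funext fun s => by ring
    rw [e]; exact (hbx.const_mul _).sub hby
  have hc : (Ay - α * Ax) * (p ^ 2 * α * Bx - By) ≤ q ^ 2 * ((By - α * Bx) * (p ^ 2 * α * Ax - Ay)) := by
    rw [hAy, hAx, hBy, hBx, ← integral_mul_sub_eq hax hay, ← integral_mul_sub_eq' hbx hby, ← integral_mul_sub_eq hbx hby,
      ← integral_mul_sub_eq' hax hay, ← integral_prod_mul, ← integral_prod_mul, ← integral_const_mul]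
    refine integral_mono (hFa.mul_prod hGb) ((hFb.mul_prod hGa).const_mul _) fun z => ?_
    have h1 : 0 ≤ y z.1 - α * x z.1 := sub_nonneg.2 (hlo z.1)
    have h2 : 0 ≤ p ^ 2 * α * x z.2 - y z.2 := sub_nonneg.2 (by rw [mul_assoc]; exact hhi z.2)
    calc a z.1 * (y z.1 - α * x z.1) * (b z.2 * (p ^ 2 * α * x z.2 - y z.2))
        = (a z.1 * b z.2) * ((y z.1 - α * x z.1) * (p ^ 2 * α * x z.2 - y z.2)) := by ring
      _ ≤ (q ^ 2 * (a z.2 * b z.1)) * ((y z.1 - α * x z.1) * (p ^ 2 * α * x z.2 - y z.2)) :=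
          mul_le_mul_of_nonneg_right (hcross z.1 z.2) (mul_nonneg h1 h2)
      _ = q ^ 2 * (b z.1 * (y z.1 - α * x z.1) * (a z.2 * (p ^ 2 * α * x z.2 - y z.2))) := by ring
  -- positivity of `u_b + v_b = (p²α − α)·∫ b x`
  have hBx0 : 0 < Bx := integral_pos_of_pos hμ (fun s => mul_pos (hb s) (hx s)) hbx
  have hp21 : 0 < p ^ 2 - 1 := by nlinarith
  have hpos : 0 < (By - α * Bx) + (p ^ 2 * α * Bx - By) := by
    have : (By - α * Bx) + (p ^ 2 * α * Bx - By) = α * (p ^ 2 - 1) * Bx := by ring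
    rw [this]; positivity
  have h4 := four_var_le hp hq (sub_nonneg.2 hua) (sub_nonneg.2 hva) (sub_nonneg.2 hub) hpos hc
  have key : α * (p ^ 2 - 1) ^ 2 * (Ay * Bx * (p + q) ^ 2) ≤ α * (p ^ 2 - 1) ^ 2 * (Ax * By * (p * q + 1) ^ 2) :=
    calc α * (p ^ 2 - 1) ^ 2 * (Ay * Bx * (p + q) ^ 2)
        = (p ^ 2 * (Ay - α * Ax) + (p ^ 2 * α * Ax - Ay)) * ((By - α * Bx) + (p ^ 2 * α * Bx - By)) * (p + q) ^ 2 := by ring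
      _ ≤ ((Ay - α * Ax) + (p ^ 2 * α * Ax - Ay)) * (p ^ 2 * (By - α * Bx) + (p ^ 2 * α * Bx - By)) * (p * q + 1) ^ 2 := h4
      _ = α * (p ^ 2 - 1) ^ 2 * (Ax * By * (p * q + 1) ^ 2) := by ring
  exact le_of_mul_le_mul_left key (by positivity)

/-! ## §2 The `d, Δ` form with Birkhoff's coefficient; the two weak bounds -/

/-- **INTEGRAL FORM WITH BIRKHOFF's COEFFICIENT** [cite: EvesonNussbaum1995, Thm 3.5 p. 39 with Thm 6.3 (11) p. 52; Hopf1963].  Rows `a, b > 0` with `a s·b s′ ≤ e^Δ·a s′·b s`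
(cross-ratio diameter `≤ Δ`, `Δ ≥ 0`), vectors `x, y > 0` with `y s·x s′ ≤ e^d·x s·y s′` (Hilbert distance `≤ d`, `d ≥ 0`), products integrable ⇒
`(∫ a y)(∫ b x)·(e^{d∕2} + e^{Δ∕2})² ≤ (∫ a x)(∫ b y)·(e^{(d+Δ)∕2} + 1)²` — §1 at `α := inf y∕x`, `p = e^{d∕2}`, `q = e^{Δ∕2}`. -/
theorem integral_mul_integral_le_birkhoff_exp (hd : 0 ≤ d) (hΔ : 0 ≤ Δ)
    (ha : ∀ s, 0 < a s) (hb : ∀ s, 0 < b s) (hx : ∀ s, 0 < x s) (hy : ∀ s, 0 < y s)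
    (hxy : ∀ s s', y s * x s' ≤ exp d * (x s * y s')) (hab : ∀ s s', a s * b s' ≤ exp Δ * (a s' * b s))
    (hax : Integrable (fun s => a s * x s) μ) (hay : Integrable (fun s => a s * y s) μ)
    (hbx : Integrable (fun s => b s * x s) μ) (hby : Integrable (fun s => b s * y s) μ) :
    (∫ s, a s * y s ∂μ) * (∫ s, b s * x s ∂μ) * (exp (d / 2) + exp (Δ / 2)) ^ 2 ≤
      (∫ s, a s * x s ∂μ) * (∫ s, b s * y s ∂μ) * (exp ((d + Δ) / 2) + 1) ^ 2 := by
  by_cases hμ : μ = 0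
  · subst hμ; simp
  have hX : Nonempty X := by
    by_contra h
    rw [not_nonempty_iff] at h
    exact hμ (Measure.eq_zero_of_isEmpty μ)
  obtain ⟨s₀⟩ := hX
  -- the ratio `r = y∕x`, its infimum `α`, and `αx ≤ y ≤ e^d αx`
  set r : X → ℝ := fun s => y s / x s with hr
  have hr0 : ∀ s, 0 < r s := fun s => div_pos (hy s) (hx s)
  have hrr : ∀ s s', r s ≤ exp d * r s' := by
    intro s s'
    have h := hxy s s'
    have hxs : x s ≠ 0 := (hx s).ne'
    have hxs' : x s' ≠ 0 := (hx s').ne'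
    calc r s = (y s * x s') / (x s * x s') := by rw [hr]; field_simp
      _ ≤ (exp d * (x s * y s')) / (x s * x s') := div_le_div_of_nonneg_right h (mul_pos (hx s) (hx s')).le
      _ = exp d * r s' := by rw [hr]; field_simp
  have hbdd : BddBelow (Set.range r) := ⟨0, by rintro _ ⟨s, rfl⟩; exact (hr0 s).le⟩
  have hne : (Set.range r).Nonempty := ⟨r s₀, s₀, rfl⟩
  set α : ℝ := sInf (Set.range r) with hα
  have hαle : ∀ s, α ≤ r s := fun s => csInf_le hbdd ⟨s, rfl⟩
  have hα0 : 0 < α := by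
    have hlow : exp (-d) * r s₀ ≤ α := le_csInf hne (by
      rintro _ ⟨s, rfl⟩
      have h := hrr s₀ s
      have e : exp (-d) * (exp d * r s) = r s := by rw [← mul_assoc, ← exp_add]; simp
      calc exp (-d) * r s₀ ≤ exp (-d) * (exp d * r s) := mul_le_mul_of_nonneg_left h (exp_pos _).le
        _ = r s := e)
    exact lt_of_lt_of_le (mul_pos (exp_pos _) (hr0 s₀)) hlow
  have hp : (1 : ℝ) ≤ exp (d / 2) := one_le_exp (by linarith)
  have hq : (1 : ℝ) ≤ exp (Δ / 2) := one_le_exp (by linarith)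
  have hp2 : exp (d / 2) ^ 2 = exp d := by rw [sq, ← exp_add]; ring_nf
  have hq2 : exp (Δ / 2) ^ 2 = exp Δ := by rw [sq, ← exp_add]; ring_nf
  have hpq : exp (d / 2) * exp (Δ / 2) = exp ((d + Δ) / 2) := by rw [← exp_add]; ring_nf
  have hlo : ∀ s, α * x s ≤ y s := fun s => by
    have := (le_div_iff₀ (hx s)).1 (hαle s)
    simpa [hr] using this
  have hhi : ∀ s, y s ≤ exp (d / 2) ^ 2 * (α * x s) := by
    intro s
    rw [hp2]
    have hup : r s ≤ exp d * α := by
      have : r s / exp d ≤ α := le_csInf hne (by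
        rintro _ ⟨s', rfl⟩
        rw [div_le_iff₀ (exp_pos d), mul_comm]
        exact hrr s s')
      rwa [div_le_iff₀ (exp_pos d), mul_comm] at this
    have := (div_le_iff₀ (hx s)).1 (show y s / x s ≤ exp d * α from hup)
    calc y s ≤ exp d * α * x s := this
      _ = exp d * (α * x s) := by ring
  have hab' : ∀ s s', a s * b s' ≤ exp (Δ / 2) ^ 2 * (a s' * b s) := fun s s' => by rw [hq2]; exact hab s s'
  have h := integral_mul_integral_le_birkhoff hp hq hα0 ha hb hx hlo hhi hab' hax hay hbx hby
  rw [hpq] at h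
  exact h

/-- **… WITH THE COEFFICIENT FOLDED IN**: `(∫ a y)(∫ b x) ≤ e^{tanh(Δ∕4)·d}·(∫ a x)(∫ b y)` — `d(Ax, Ay) ≤ tanh(Δ(A)∕4)·d(x, y)` for
the integral operator. [cite: EvesonNussbaum1995, Thm 3.5 p. 39 with Thm 6.3 p. 52; LemmensNussbaum2014, Thm 2.9; Hopf1963] -/
theorem integral_mul_integral_le_exp_tanh_mul (hd : 0 ≤ d) (hΔ : 0 ≤ Δ)
    (ha : ∀ s, 0 < a s) (hb : ∀ s, 0 < b s) (hx : ∀ s, 0 < x s) (hy : ∀ s, 0 < y s)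
    (hxy : ∀ s s', y s * x s' ≤ exp d * (x s * y s')) (hab : ∀ s s', a s * b s' ≤ exp Δ * (a s' * b s))
    (hax : Integrable (fun s => a s * x s) μ) (hay : Integrable (fun s => a s * y s) μ)
    (hbx : Integrable (fun s => b s * x s) μ) (hby : Integrable (fun s => b s * y s) μ) :
    (∫ s, a s * y s ∂μ) * (∫ s, b s * x s ∂μ) ≤ exp (Real.tanh (Δ / 4) * d) * ((∫ s, a s * x s ∂μ) * (∫ s, b s * y s ∂μ)) := by
  have h := integral_mul_integral_le_birkhoff_exp hd hΔ ha hb hx hy hxy hab hax hay hbx hby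
  have hP : 0 < exp (d / 2) + exp (Δ / 2) := by positivity
  have hQ : 0 < exp ((d + Δ) / 2) + 1 := by positivity
  have hAx : 0 ≤ ∫ s, a s * x s ∂μ := integral_nonneg fun s => (mul_pos (ha s) (hx s)).le
  have hBy : 0 ≤ ∫ s, b s * y s ∂μ := integral_nonneg fun s => (mul_pos (hb s) (hy s)).le
  have hZ : 0 < (exp ((d + Δ) / 2) + 1) / (exp (d / 2) + exp (Δ / 2)) := div_pos hQ hP
  have hexp : exp (2 * log ((exp ((d + Δ) / 2) + 1) / (exp (d / 2) + exp (Δ / 2))))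
      = ((exp ((d + Δ) / 2) + 1) / (exp (d / 2) + exp (Δ / 2))) ^ 2 := by
    rw [show (2 : ℝ) * log ((exp ((d + Δ) / 2) + 1) / (exp (d / 2) + exp (Δ / 2)))
        = ((2 : ℕ) : ℝ) * log ((exp ((d + Δ) / 2) + 1) / (exp (d / 2) + exp (Δ / 2))) by norm_num,
      ← log_pow, exp_log (pow_pos hZ 2)]
  calc (∫ s, a s * y s ∂μ) * (∫ s, b s * x s ∂μ)
      ≤ (∫ s, a s * x s ∂μ) * (∫ s, b s * y s ∂μ) * (exp ((d + Δ) / 2) + 1) ^ 2 / (exp (d / 2) + exp (Δ / 2)) ^ 2 :=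
        (le_div_iff₀ (pow_pos hP 2)).2 h
    _ = ((exp ((d + Δ) / 2) + 1) / (exp (d / 2) + exp (Δ / 2))) ^ 2 * ((∫ s, a s * x s ∂μ) * (∫ s, b s * y s ∂μ)) := by
        rw [div_pow]; ring
    _ ≤ exp (Real.tanh (Δ / 4) * d) * ((∫ s, a s * x s ∂μ) * (∫ s, b s * y s ∂μ)) := by
        rw [← hexp]
        exact mul_le_mul_of_nonneg_right (exp_le_exp.2 (two_mul_log_birkhoff_le_tanh_mul hd hΔ)) (mul_nonneg hAx hBy)

/-- **WEAK BOUND I — MONOTONICITY**: ANY non-negative rows never expand the distance: `(∫ a y)(∫ b x) ≤ e^d·(∫ a x)(∫ b y)`.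
[cite: EvesonNussbaum1995, Lemma 3.1 (4) p. 37 and Thm 3.6 p. 39] -/
theorem integral_mul_integral_le_exp_dist (ha : ∀ s, 0 ≤ a s) (hb : ∀ s, 0 ≤ b s)
    (hxy : ∀ s s', y s * x s' ≤ exp d * (x s * y s'))
    (hax : Integrable (fun s => a s * x s) μ) (hay : Integrable (fun s => a s * y s) μ)
    (hbx : Integrable (fun s => b s * x s) μ) (hby : Integrable (fun s => b s * y s) μ) :
    (∫ s, a s * y s ∂μ) * (∫ s, b s * x s ∂μ) ≤ exp d * ((∫ s, a s * x s ∂μ) * (∫ s, b s * y s ∂μ)) := by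
  rw [← integral_prod_mul, ← integral_prod_mul, ← integral_const_mul]
  refine integral_mono (hay.mul_prod hbx) ((hax.mul_prod hby).const_mul _) fun z => ?_
  calc a z.1 * y z.1 * (b z.2 * x z.2) = (a z.1 * b z.2) * (y z.1 * x z.2) := by ring
    _ ≤ (a z.1 * b z.2) * (exp d * (x z.1 * y z.2)) :=
        mul_le_mul_of_nonneg_left (hxy z.1 z.2) (mul_nonneg (ha z.1) (hb z.2))
    _ = exp d * (a z.1 * x z.1 * (b z.2 * y z.2)) := by ring

/-- **WEAK BOUND II — THE DIAMETER**: for ANY non-negative vectors the image distance is at most the rows' diameter: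
`(∫ a y)(∫ b x) ≤ e^Δ·(∫ a x)(∫ b y)`. [cite: EvesonNussbaum1995, Def 3.3 p. 38 and Thm 6.3 (11) p. 52, Remark 6.4 p. 53] -/
theorem integral_mul_integral_le_exp_diam (hx : ∀ s, 0 ≤ x s) (hy : ∀ s, 0 ≤ y s)
    (hab : ∀ s s', a s * b s' ≤ exp Δ * (a s' * b s))
    (hax : Integrable (fun s => a s * x s) μ) (hay : Integrable (fun s => a s * y s) μ)
    (hbx : Integrable (fun s => b s * x s) μ) (hby : Integrable (fun s => b s * y s) μ) :
    (∫ s, a s * y s ∂μ) * (∫ s, b s * x s ∂μ) ≤ exp Δ * ((∫ s, a s * x s ∂μ) * (∫ s, b s * y s ∂μ)) := by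
  rw [mul_comm (∫ s, a s * x s ∂μ), ← integral_prod_mul, ← integral_prod_mul, ← integral_const_mul]
  refine integral_mono (hay.mul_prod hbx) ((hby.mul_prod hax).const_mul _) fun z => ?_
  calc a z.1 * y z.1 * (b z.2 * x z.2) = (a z.1 * b z.2) * (y z.1 * x z.2) := by ring
    _ ≤ (exp Δ * (a z.2 * b z.1)) * (y z.1 * x z.2) :=
        mul_le_mul_of_nonneg_right (hab z.1 z.2) (mul_nonneg (hy z.1) (hx z.2))
    _ = exp Δ * (b z.1 * y z.1 * (a z.2 * x z.2)) := by ring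

end TwoRows

/-! ## §3 Iteration: a chain of density kernels of diameter `≤ Δ` contracts geometrically -/

section Chain

variable [SFinite μ] {k : ℕ → X → X → ℝ} {fA fB : ℕ → X → ℝ} {ω₀ Δ : ℝ}

omit [SFinite μ] in
/-- Positivity of the evolved densities (plumbing). [cite: EvesonNussbaum1995, Thm 6.3 (proof, p. 53)] -/
theorem densityChain_pos (hμ : μ ≠ 0) (hk : ∀ j x y, 0 < k j x y) (hA0 : ∀ x, 0 < fA 0 x)
    (hAs : ∀ j y, fA (j + 1) y = ∫ x, k j x y * fA j x ∂μ) (hint : ∀ j y, Integrable (fun x => k j x y * fA j x) μ)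
    (n : ℕ) : ∀ y, 0 < fA n y := by
  induction n with
  | zero => exact hA0
  | succ n ih =>
    intro y
    rw [hAs n y]
    exact integral_pos_of_pos hμ (fun x => mul_pos (hk n x y) (ih x)) (hint n y)

/-- **GEOMETRIC CONTRACTION ALONG A CHAIN OF DENSITY KERNELS** [cite: LemmensNussbaum2014, Thm 2.11 (`d(L^{kp}x, v) ≤ c^k d(x, v)`);
EvesonNussbaum1995, Thm 3.5 p. 39; Hopf1963].  Two positive densities evolved by
the SAME positive kernels `k j` of cross-ratio diameter `≤ Δ` (`f (j+1) y = ∫ k j x y · f j x dμ`), whose initial Hilbert distance is `≤ ω₀`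
(`fB 0 x · fA 0 x′ ≤ e^{ω₀}·fA 0 x·fB 0 x′`), are at distance `≤ tanh(Δ∕4)^n·ω₀` after `n` steps — the measure-space twin of `chain_dist_le_pow`. -/
theorem densityChain_dist_le_pow (hμ : μ ≠ 0) (hω₀ : 0 ≤ ω₀) (hΔ : 0 ≤ Δ) (hk : ∀ j x y, 0 < k j x y)
    (hdiam : ∀ (j : ℕ) (y y' x x' : X), k j x y * k j x' y' ≤ exp Δ * (k j x' y * k j x y'))
    (hA0 : ∀ x, 0 < fA 0 x) (hB0 : ∀ x, 0 < fB 0 x)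
    (hAs : ∀ j y, fA (j + 1) y = ∫ x, k j x y * fA j x ∂μ) (hBs : ∀ j y, fB (j + 1) y = ∫ x, k j x y * fB j x ∂μ)
    (hint : ∀ j y, Integrable (fun x => k j x y * fA j x) μ) (hintB : ∀ j y, Integrable (fun x => k j x y * fB j x) μ)
    (h0 : ∀ x x', fB 0 x * fA 0 x' ≤ exp ω₀ * (fA 0 x * fB 0 x')) (n : ℕ) :
    ∀ x x', fB n x * fA n x' ≤ exp (Real.tanh (Δ / 4) ^ n * ω₀) * (fA n x * fB n x') := by
  induction n with
  | zero => simpa only [pow_zero, one_mul] using h0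
  | succ n ih =>
    intro y y'
    have hAn := densityChain_pos hμ hk hA0 hAs hint n
    have hBn := densityChain_pos hμ hk hB0 hBs hintB n
    have hdn : 0 ≤ Real.tanh (Δ / 4) ^ n * ω₀ := mul_nonneg (pow_nonneg (tanh_quarter_nonneg hΔ) n) hω₀
    have e : Real.tanh (Δ / 4) ^ (n + 1) * ω₀ = Real.tanh (Δ / 4) * (Real.tanh (Δ / 4) ^ n * ω₀) := by ring
    rw [hBs n y, hAs n y', hAs n y, hBs n y', e]
    exact integral_mul_integral_le_exp_tanh_mul (μ := μ) (a := fun x => k n x y) (b := fun x => k n x y') (x := fA n) (y := fB n)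
      hdn hΔ (fun x => hk n x y) (fun x => hk n x y') hAn hBn ih (fun x x' => hdiam n y y' x x')
      (hint n y) (hintB n y) (hint n y') (hintB n y')

end Chain

end BirkhoffHopf

end Literature.Dynamics.Contraction

end
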